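import Literature.Computability.AlgebraicComplexity.DetInVP
import Literature.Computability.AlgebraicComplexity.ConstantFreeCircuits
import HarnessLib

set_option linter.dupNamespace false

/-!
# Stub `stub_tauDetCF` — `τ(DET_m) = m^{O(1)}` for the constant-free measure (Berkowitz 1984)

Crux `TauBurgisserDet` (item `stmt-ValiantsHypothesis-7680`), line `registered`: the constant-free
complexity `constantFreeComplexity` (`τ`: fan-in-two circuits with all constants and sum
coefficients in `{0, 1, -1}`) of the generic determinant `detPoly (Fin m) ℤ = det (X_{ij})` is
p-bounded.

The tree proves Berkowitz's division-free determinant circuit for Bürgisser's measure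
`complexity` (constants allowed) in `Literature/Computability/AlgebraicComplexity/DetInVP.lean`
(`complexity_detPoly_le : L(DET_n) ≤ 8 (n+1)⁷`): `det (X_{ij})` is ONE instance
`IMM_{n+1,n+1}((-1)^n e₀e₀ᵀ, toep (n-1), …, toep 0)` of the iterated matrix multiplication
polynomial (`Berkowitz.aeval_detSubst_immPoly`), every Toeplitz entry `-R_t M_t^q S_t` being again
an instance `IMM_{t,q+1}(S_t ⊗ R_t, M_t, …, M_t)` (`Berkowitz.berkNum_eq_aeval`). Berkowitz's
algorithm uses no constants other than `0, ±1`, so the same circuits are constant-free: here the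
cost analysis is re-run verbatim for `τ` over `ℤ` with the `τ`-calculus of
`ConstantFreeCircuits.lean` (`constantFreeComplexity_aeval_le`: `τ(f(g)) ≤ τ(f) + ∑ τ(g_v)`;
`τ(fg) ≤ τ f + τ g + 1`, `τ(-f) ≤ τ f + 1`, `τ(X_i) = τ(0) = τ(±1) = 0`,
`τ(∑_s f_i) ≤ ∑ τ(f_i) + #s`):

* `tdc_constantFreeComplexity_immPoly_succ_le : τ(IMM_{N,d+1}) ≤ N + 2 N³ d` (one matrix at a
  time, Kumar–Saraf 2017 §3, as in `complexity_immPoly_le`);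
* `tdc_constantFreeComplexity_berkNum_le : τ(R_t M_t^q S_t) ≤ t + 2t³(q+1) + t²`;
* `tdc_constantFreeComplexity_detPoly_le : τ(DET_n) ≤ 8 (n+1)⁷`, whence `stub_tauDetCF`.

## References

* [Berkowitz1984] S. J. Berkowitz, *On computing the determinant in small parallel time using a
  small number of processors*, Inform. Process. Lett. 18 (1984) 147–150.
* [Soltys2002] M. Soltys, *Berkowitz's algorithm and clow sequences*, Electron. J. Linear
  Algebra 9 (2002) 42–54, §2, Def. 2.
* [Burgisser2000] P. Bürgisser, *Completeness and Reduction in Algebraic Complexity Theory*,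
  Springer 2000, §1.4 (constant-free model), Rem. 2.7 (substitution), Prop. 2.30 (`DET ∈ VP`).
* [KumarSaraf2017] M. Kumar, S. Saraf, SIAM J. Comput. 46 (2017), §3 (`IMM ∈ VP`).
-/

noncomputable section

open MvPolynomial

namespace Summit.ValiantsHypothesis.ValiantsHypothesis.Theorems.IntegralOrbitsTauBurgisserDet

open Literature.Computability.AlgebraicComplexity

/-! ### `τ(IMM_{N,d})`: one matrix at a time, constant-free -/

/-- **One matrix at a time, constant-free.** `IMM_{N,d+2} = tr(X⁽⁰⁾ ⋯ X⁽ᵈ⁺¹⁾)` is the image of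
`IMM_{N,d+1}` under the substitution `Y⁽⁰⁾_{ij} ↦ ∑_l X⁽⁰⁾_{il} X⁽¹⁾_{lj}`, `Y⁽ᵗ⁾ ↦ X⁽ᵗ⁺¹⁾`
(`t ≥ 1`), whose entries are constant-free of total cost `∑_v τ(g v) ≤ 2 N³` (the `complexity`
twin is `exists_immPoly_succ_succ`). [cite: KumarSaraf2017, §3] [cite: Burgisser2000, §1.4] -/
theorem tdc_exists_immPoly_succ_succ (N d : ℕ) :
    ∃ g : Fin (d + 1) × Fin N × Fin N → MvPolynomial (Fin (d + 2) × Fin N × Fin N) ℤ,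
      immPoly N (d + 2) ℤ = aeval g (immPoly N (d + 1) ℤ) ∧
        ∑ v, constantFreeComplexity (g v) ≤ 2 * N ^ 3 := by
  classical
  -- the generic matrices `G e t = X⁽ᵗ⁾` among `e`, as in the definition of `immMatrix`
  set G : (e : ℕ) → Fin e → Matrix (Fin N) (Fin N) (MvPolynomial (Fin e × Fin N × Fin N) ℤ) :=
    fun e t => (Matrix.mvPolynomialX (Fin N) (Fin N) ℤ).map
      (rename fun ij : Fin N × Fin N => (t, ij)) with hGdef
  have hG : ∀ (e : ℕ) (t : Fin e) (i j : Fin N), G e t i j = X (t, i, j) := fun e t i j => by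
    simp [hGdef, Matrix.mvPolynomialX]
  have himm : ∀ e : ℕ, immMatrix (Fin N) e ℤ = ((List.finRange e).map (G e)).prod := fun e => rfl
  -- the substitution
  set g : Fin (d + 1) × Fin N × Fin N → MvPolynomial (Fin (d + 2) × Fin N × Fin N) ℤ :=
    fun v => if v.1 = 0 then ∑ l : Fin N, X (0, v.2.1, l) * X (1, l, v.2.2)
      else X (v.1.succ, v.2.1, v.2.2) with hgdef
  have hg0 : ∀ i j : Fin N, g (0, i, j) = ∑ l : Fin N, X (0, i, l) * X (1, l, j) := fun i j => by
    simp [hgdef]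
  have hgs : ∀ (t : Fin d) (i j : Fin N), g (t.succ, i, j) = X (t.succ.succ, i, j) :=
    fun t i j => by simp [hgdef, Fin.succ_ne_zero]
  refine ⟨g, ?_, ?_⟩
  · -- the matrix identity `X⁽⁰⁾ ⋯ X⁽ᵈ⁺¹⁾ = (Y⁽⁰⁾ ⋯ Y⁽ᵈ⁾)(g)`
    set F : MvPolynomial (Fin (d + 1) × Fin N × Fin N) ℤ →+*
        MvPolynomial (Fin (d + 2) × Fin N × Fin N) ℤ := (aeval g).toRingHom with hFdef
    have hF : ∀ p, F p = aeval g p := fun p => rfl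
    have h0 : F.mapMatrix (G (d + 1) 0) = G (d + 2) 0 * G (d + 2) 1 := by
      ext i j
      simp [RingHom.mapMatrix_apply, Matrix.mul_apply, hG, hF, hg0]
    have hs : ∀ t : Fin d, F.mapMatrix (G (d + 1) t.succ) = G (d + 2) t.succ.succ := by
      intro t
      ext i j
      simp [RingHom.mapMatrix_apply, hG, hF, hgs]
    have hM : immMatrix (Fin N) (d + 2) ℤ = F.mapMatrix (immMatrix (Fin N) (d + 1) ℤ) := by
      rw [himm, himm, map_list_prod, List.map_map, List.finRange_succ, List.finRange_succ]
      simp only [List.map_cons, List.map_map, List.prod_cons, Function.comp_def, h0, hs,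
        Matrix.mul_assoc, Fin.succ_zero_eq_one]
    unfold immPoly
    rw [hM, RingHom.mapMatrix_apply, ← hF]
    exact (AddMonoidHom.map_trace F.toAddMonoidHom _).symm
  · -- the cost of the substitution
    have h0 : ∀ i j : Fin N, constantFreeComplexity (g (0, i, j)) ≤ 2 * N := by
      intro i j
      rw [hg0]
      refine (constantFreeComplexity_finset_sum_le _ _).trans ?_
      have hterm : ∀ l : Fin N,
          constantFreeComplexity (X (((0 : Fin (d + 2)), i, l) : Fin (d + 2) × Fin N × Fin N) *
            X (((1 : Fin (d + 2)), l, j) : Fin (d + 2) × Fin N × Fin N) : MvPolynomial _ ℤ) ≤ 1 :=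
        fun l => (constantFreeComplexity_mul_le _ _).trans
          (by rw [constantFreeComplexity_X, constantFreeComplexity_X])
      calc ∑ l : Fin N, constantFreeComplexity
              (X (((0 : Fin (d + 2)), i, l) : Fin (d + 2) × Fin N × Fin N) *
              X (((1 : Fin (d + 2)), l, j) : Fin (d + 2) × Fin N × Fin N) : MvPolynomial _ ℤ) +
              (Finset.univ : Finset (Fin N)).card
          ≤ ∑ _l : Fin N, 1 + (Finset.univ : Finset (Fin N)).card := by
            gcongr with l _
            exact hterm l
        _ = 2 * N := by simp; ring
    have hs : ∀ (t : Fin d) (i j : Fin N), constantFreeComplexity (g (t.succ, i, j)) = 0 := by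
      intro t i j
      rw [hgs]
      exact constantFreeComplexity_X _
    calc ∑ v, constantFreeComplexity (g v)
        = ∑ t : Fin (d + 1), ∑ i : Fin N, ∑ j : Fin N,
            constantFreeComplexity (g (t, i, j)) := by
          rw [Fintype.sum_prod_type]
          exact Finset.sum_congr rfl fun t _ => Fintype.sum_prod_type _
      _ = ∑ i : Fin N, ∑ j : Fin N, constantFreeComplexity (g (0, i, j)) := by
          rw [Fin.sum_univ_succ]
          simp [hs]
      _ ≤ ∑ _i : Fin N, ∑ _j : Fin N, 2 * N :=
          Finset.sum_le_sum fun i _ => Finset.sum_le_sum fun j _ => h0 i j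
      _ = 2 * N ^ 3 := by simp; ring

/-- `τ(IMM_{N,1}) = τ(∑ᵢ X⁽⁰⁾_{ii}) ≤ N`. [cite: KumarSaraf2017, §3] -/
theorem tdc_constantFreeComplexity_immPoly_one_le (N : ℕ) :
    constantFreeComplexity (immPoly N 1 ℤ) ≤ N := by
  classical
  have h : immPoly N 1 ℤ = ∑ i : Fin N, X (((0 : Fin 1), i, i) : Fin 1 × Fin N × Fin N) := by
    simp [immPoly, immMatrix, List.finRange_succ, Matrix.trace, Matrix.mvPolynomialX]
  rw [h]
  refine (constantFreeComplexity_finset_sum_le _ _).trans ?_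
  have hX : ∀ i : Fin N, constantFreeComplexity
      (X (((0 : Fin 1), i, i) : Fin 1 × Fin N × Fin N) : MvPolynomial _ ℤ) = 0 :=
    fun i => constantFreeComplexity_X _
  simp [hX]

/-- **`τ(IMM_{N,d+1}) ≤ N + 2 N³ d`**: the iterated-product circuit of Kumar–Saraf §3 is
constant-free. [cite: KumarSaraf2017, §3] [cite: Burgisser2000, §1.4] -/
theorem tdc_constantFreeComplexity_immPoly_succ_le (N d : ℕ) :
    constantFreeComplexity (immPoly N (d + 1) ℤ) ≤ N + 2 * N ^ 3 * d := by
  induction d with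
  | zero => simpa using tdc_constantFreeComplexity_immPoly_one_le N
  | succ d ih =>
    obtain ⟨g, hg, hcost⟩ := tdc_exists_immPoly_succ_succ N d
    rw [hg]
    calc constantFreeComplexity (aeval g (immPoly N (d + 1) ℤ))
        ≤ constantFreeComplexity (immPoly N (d + 1) ℤ) + ∑ v, constantFreeComplexity (g v) :=
          constantFreeComplexity_aeval_le _ _
      _ ≤ (N + 2 * N ^ 3 * d) + 2 * N ^ 3 := Nat.add_le_add ih hcost
      _ = N + 2 * N ^ 3 * (d + 1) := by ring

/-! ### Cost of Berkowitz's substitutions, constant-free -/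

section BerkowitzCost

variable {n : ℕ}

/-- `(-1)^n ∈ {0, 1, -1}`: the only constant of Berkowitz's circuit is a sign.
[cite: Burgisser2000, §1.4] -/
theorem tdc_isSignConstant_neg_one_pow (n : ℕ) : ArithCircuit.IsSignConstant ((-1 : ℤ) ^ n) := by
  rcases neg_one_pow_eq_or ℤ n with h | h
  · exact Or.inr (Or.inl h)
  · exact Or.inr (Or.inr (by rw [h]; norm_num))

/-- The entries `X_{ab}` (or `0`) are free: `τ(xvar a b) = 0`. [cite: Burgisser2000, Def. 2.1] -/
theorem tdc_constantFreeComplexity_xvar (a b : ℕ) :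
    constantFreeComplexity (Berkowitz.xvar ℤ n a b) = 0 := by
  unfold Berkowitz.xvar
  split_ifs
  · exact constantFreeComplexity_X _
  · exact constantFreeComplexity_zero

/-- **`τ(R_t M_t^q S_t) ≤ t + 2t³(q+1) + t²`** by the constant-free `IMM` circuit and the
substitution bound for `τ`. [cite: KumarSaraf2017, §3] [cite: Burgisser2000, Rem. 2.7] -/
theorem tdc_constantFreeComplexity_berkNum_le (t q : ℕ) :
    constantFreeComplexity (Berkowitz.berkNum ℤ n t q) ≤ t + 2 * t ^ 3 * (q + 1) + t ^ 2 := by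
  rw [Berkowitz.berkNum_eq_aeval]
  have h0 : ∀ i j : Fin t,
      constantFreeComplexity (Berkowitz.berkSubst ℤ n t q (0, i, j)) ≤ 1 := by
    intro i j
    simp only [Berkowitz.berkSubst, Fin.val_zero, ↓reduceIte]
    calc constantFreeComplexity (Berkowitz.xvar ℤ n i t * Berkowitz.xvar ℤ n t j)
        ≤ constantFreeComplexity (Berkowitz.xvar ℤ n i t) +
            constantFreeComplexity (Berkowitz.xvar ℤ n t j) + 1 :=
          constantFreeComplexity_mul_le _ _
      _ = 1 := by rw [tdc_constantFreeComplexity_xvar, tdc_constantFreeComplexity_xvar]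
  have hs : ∀ (u : Fin q) (i j : Fin t),
      constantFreeComplexity (Berkowitz.berkSubst ℤ n t q (u.succ, i, j)) = 0 := by
    intro u i j
    simp only [Berkowitz.berkSubst, Fin.val_succ, Nat.add_one_ne_zero, ↓reduceIte]
    exact tdc_constantFreeComplexity_xvar _ _
  have hsum : ∑ v, constantFreeComplexity (Berkowitz.berkSubst ℤ n t q v) ≤ t ^ 2 := by
    calc ∑ v, constantFreeComplexity (Berkowitz.berkSubst ℤ n t q v)
        = ∑ u : Fin (q + 1), ∑ i : Fin t, ∑ j : Fin t,
            constantFreeComplexity (Berkowitz.berkSubst ℤ n t q (u, i, j)) := by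
          rw [Fintype.sum_prod_type]
          exact Finset.sum_congr rfl fun u _ => Fintype.sum_prod_type _
      _ = ∑ i : Fin t, ∑ j : Fin t,
            constantFreeComplexity (Berkowitz.berkSubst ℤ n t q (0, i, j)) := by
          rw [Fin.sum_univ_succ]
          simp [hs]
      _ ≤ ∑ _i : Fin t, ∑ _j : Fin t, 1 :=
          Finset.sum_le_sum fun i _ => Finset.sum_le_sum fun j _ => h0 i j
      _ = t ^ 2 := by simp; ring
  calc constantFreeComplexity (aeval (Berkowitz.berkSubst ℤ n t q) (immPoly t (q + 1) ℤ))
      ≤ constantFreeComplexity (immPoly t (q + 1) ℤ) +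
          ∑ v, constantFreeComplexity (Berkowitz.berkSubst ℤ n t q v) :=
        constantFreeComplexity_aeval_le _ _
    _ ≤ (t + 2 * t ^ 3 * q) + t ^ 2 :=
        Nat.add_le_add (tdc_constantFreeComplexity_immPoly_succ_le t q) hsum
    _ ≤ (t + 2 * t ^ 3 * (q + 1)) + t ^ 2 :=
        Nat.add_le_add_right (Nat.add_le_add_left (Nat.mul_le_mul_left _ (Nat.le_succ q)) _) _

/-- Every entry of every (padded) Toeplitz factor is constant-free of cost at most `5 (n+1)⁴`.
[cite: Soltys2002, §2 Def. 2] [cite: Burgisser2000, Rem. 2.7] -/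
theorem tdc_constantFreeComplexity_toepEntry_le (t l p : ℕ) (ht : t ≤ n) :
    constantFreeComplexity (Berkowitz.toepEntry ℤ n t l p) ≤ 5 * (n + 1) ^ 4 := by
  have h4 : 1 ≤ (n + 1) ^ 4 := Nat.one_le_pow _ _ (by omega)
  unfold Berkowitz.toepEntry
  split_ifs with h1 h2 h3
  · rw [constantFreeComplexity_one]
    exact Nat.zero_le _
  · calc constantFreeComplexity (-Berkowitz.xvar ℤ n t t)
        ≤ constantFreeComplexity (Berkowitz.xvar ℤ n t t) + 1 := constantFreeComplexity_neg_le _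
      _ = 1 := by rw [tdc_constantFreeComplexity_xvar]
      _ ≤ 5 * (n + 1) ^ 4 := by omega
  · calc constantFreeComplexity (-Berkowitz.berkNum ℤ n t (p - (l + 1)))
        ≤ constantFreeComplexity (Berkowitz.berkNum ℤ n t (p - (l + 1))) + 1 :=
          constantFreeComplexity_neg_le _
      _ ≤ t + 2 * t ^ 3 * (p - (l + 1) + 1) + t ^ 2 + 1 :=
          Nat.add_le_add_right (tdc_constantFreeComplexity_berkNum_le t _) 1
      _ ≤ 5 * (n + 1) ^ 4 := Berkowitz.berk_cost_le ht (by omega)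
  · rw [constantFreeComplexity_zero]
    exact Nat.zero_le _

/-- Every entry substituted into `IMM_{n+1,n+1}` is constant-free of cost at most `5 (n+1)⁴`
(the head entry is the sign `(-1)^n` or `0`). [cite: Burgisser2000, Rem. 2.7] -/
theorem tdc_constantFreeComplexity_detSubst_le (v : Fin (n + 1) × Fin (n + 1) × Fin (n + 1)) :
    constantFreeComplexity (Berkowitz.detSubst ℤ n v) ≤ 5 * (n + 1) ^ 4 := by
  unfold Berkowitz.detSubst
  split_ifs with h
  · by_cases h0 : (0 : Fin (n + 1)) = v.2.1 ∧ (0 : Fin (n + 1)) = v.2.2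
    · rw [Matrix.single, Matrix.of_apply, if_pos h0,
        constantFreeComplexity_C_of_isSignConstant (tdc_isSignConstant_neg_one_pow n)]
      exact Nat.zero_le _
    · rw [Matrix.single, Matrix.of_apply, if_neg h0, constantFreeComplexity_zero]
      exact Nat.zero_le _
  · exact tdc_constantFreeComplexity_toepEntry_le _ _ _ (Nat.sub_le _ _)

end BerkowitzCost

/-! ### The size bound and the stub -/

/-- **`τ(DET_n) ≤ 8 (n+1)⁷`**: Berkowitz's algorithm as one constant-free iterated matrix
product. [cite: Berkowitz1984, §2] [cite: Soltys2002, §2 Def. 2] [cite: KumarSaraf2017, §3] -/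
theorem tdc_constantFreeComplexity_detPoly_le (n : ℕ) :
    constantFreeComplexity (detPoly (Fin n) ℤ) ≤ 8 * (n + 1) ^ 7 := by
  rw [← Berkowitz.aeval_detSubst_immPoly (k := ℤ) (n := n)]
  have hsum : ∑ v, constantFreeComplexity (Berkowitz.detSubst ℤ n v) ≤
      (n + 1) ^ 3 * (5 * (n + 1) ^ 4) := by
    calc ∑ v, constantFreeComplexity (Berkowitz.detSubst ℤ n v)
        ≤ (Finset.univ : Finset (Fin (n + 1) × Fin (n + 1) × Fin (n + 1))).card •
            (5 * (n + 1) ^ 4) :=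
          Finset.sum_le_card_nsmul _ _ _ fun v _ => tdc_constantFreeComplexity_detSubst_le v
      _ = (n + 1) ^ 3 * (5 * (n + 1) ^ 4) := by
          simp only [Finset.card_univ, Fintype.card_prod, Fintype.card_fin, smul_eq_mul]; ring
  calc constantFreeComplexity (aeval (Berkowitz.detSubst ℤ n) (immPoly (n + 1) (n + 1) ℤ))
      ≤ constantFreeComplexity (immPoly (n + 1) (n + 1) ℤ) +
          ∑ v, constantFreeComplexity (Berkowitz.detSubst ℤ n v) :=
        constantFreeComplexity_aeval_le _ _
    _ ≤ ((n + 1) + 2 * (n + 1) ^ 3 * n) + (n + 1) ^ 3 * (5 * (n + 1) ^ 4) :=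
        Nat.add_le_add (tdc_constantFreeComplexity_immPoly_succ_le (n + 1) n) hsum
    _ ≤ 8 * (n + 1) ^ 7 := by
        have h1 : n + 1 ≤ (n + 1) ^ 7 := by
          calc n + 1 = (n + 1) ^ 1 := (pow_one _).symm
            _ ≤ (n + 1) ^ 7 := Nat.pow_le_pow_right (by omega) (by omega)
        have h2 : 2 * (n + 1) ^ 3 * n ≤ 2 * (n + 1) ^ 7 := by
          calc 2 * (n + 1) ^ 3 * n ≤ 2 * (n + 1) ^ 3 * (n + 1) :=
                Nat.mul_le_mul_left _ (Nat.le_succ n)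
            _ = 2 * (n + 1) ^ 4 := by ring
            _ ≤ 2 * (n + 1) ^ 7 :=
                Nat.mul_le_mul_left 2 (Nat.pow_le_pow_right (by omega) (by omega))
        have h3 : (n + 1) ^ 3 * (5 * (n + 1) ^ 4) = 5 * (n + 1) ^ 7 := by ring
        omega

/-- **Stub `stub_tauDetCF`** — `τ(DET_m) = m^{O(1)}` for the constant-free measure: Berkowitz's
division-free determinant circuit uses only the constants `0, ±1`, so
`τ(detPoly (Fin m) ℤ) ≤ 8 (m+1)⁷` (`tdc_constantFreeComplexity_detPoly_le`), which is p-bounded.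
[cite: Berkowitz1984, §2] [cite: Burgisser2000, Prop. 2.30] -/
theorem stub_tauDetCF :
    Literature.Computability.AlgebraicComplexity.IsPBounded fun m =>
      Literature.Computability.AlgebraicComplexity.constantFreeComplexity
        (Literature.Computability.AlgebraicComplexity.detPoly (Fin m) ℤ) :=
  (IsPBounded.iff_exists_le_mul_succ_pow _).2
    ⟨8, 7, fun m => tdc_constantFreeComplexity_detPoly_le m⟩

end Summit.ValiantsHypothesis.ValiantsHypothesis.Theorems.IntegralOrbitsTauBurgisserDet
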